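import Summits.BirchSwinnertonDyer.BirchSwinnertonDyer.Theorems.BiquadraticEisensteinDescentHeegnerTwistCouplingInSupplySylvesterTwistPhiSha
import HarnessLib

set_option linter.dupNamespace false -- `Summit.BirchSwinnertonDyer.BirchSwinnertonDyer.Theorems.…` (summit = sub, D-0017)
set_option autoImplicit false

/-!
# Crux `HeegnerTwistCouplingInSupply` (stmt-BirchSwinnertonDyer-21381) — programme «TWISTED 3-ISOGENY DESCENT», file P7c-A1:
# the two sharp halves in KERNEL form and the `3`-torsion of `y² = x³ + B`

Route `BiquadraticEisensteinDescent` (cell `pub/bsd-wall`, width seat `bsd-wall-cm-bed-w4` g33; `--supports` 21381, helper). Inputs of the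
assembly `Ш(E/ℚ)[3] = 0` (file P7c-A2 `…SylvesterTwistShaThree`) for the Sylvester twist `E : y² = x³ − 2p²`:

* §1 `three_nsmul_some_eq_zero` — the `3`-torsion of `y² = x³ + B` over any field of characteristic `0`: `3·(x, y) = O` forces `y ≠ 0`
  and `x(x³ + 4B) = 0` (Knapp's duplication argument `2P = −P`; the tree's `MordellCurveTorsion` does this over `ℚ`, here redone verbatim
  for an arbitrary field so that it applies to `ℚ̄`-points);
* §2 ★ `eq_zero_of_mem_sha_of_galH1Map_eq_zero_of_ker_x_zero_phi` / `…_phiHat` — the sharp halves P7b (`E = mordellCurve(−2p²)`, (h1),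
  Kummer field `ℚ(√6)`) / P7a (`E' = mordellCurve(54p²)`, (h2) `9 ∤ a`, Kummer field `ℚ(√−2)`) in KERNEL form: for ANY `Γ_ℚ`-equivariant
  surjection `f` out of `E(ℚ̄)` (resp. `E'(ℚ̄)`) killing the points with `x = 0` and with kernel inside `{O} ∪ {x = 0}`, every class of `Ш`
  killed by `f_*` vanishes (the generic `TwistedKummer.eq_zero_of_mem_sha_of_galH1Map_eq_zero_of_box_transport` fed with the boxes P5c / P6c₂;
  P7a/P7b stated this for Vélu maps only — the dual isogenies need the kernel form).

HONEST FRAMING: support lemmas for `Ш[3] = 0` of ONE CM family under the decidable certificates (h1), (h2); the rank, `hDescU`, the crux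
(residual C⁺) and BSD are untouched. THEOREMS ONLY (no `def`, no named fact, no sorry). Supports stmt-BirchSwinnertonDyer-21381.
[cite: CohenPazuki2009, Proposition 2.2 and §4] [cite: SilvermanAEC2009, Thm. X.4.2 (a)] [cite: Knapp1993, Ch. V §6, proof of Thm. 5.3]
-/

noncomputable section

open scoped Classical

namespace Summit.BirchSwinnertonDyer.BirchSwinnertonDyer.Theorems.SylvesterTwistDescent

open Literature.NumberTheory.EllipticCurves Literature.NumberTheory.EllipticCurves.MordellDescent
open Literature.NumberTheory.EllipticCurves.TwistedKummer Literature.NumberTheory.QuadraticFields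
open Literature.NumberTheory.GaloisRepresentations NumberField
open WeierstrassCurve

/-! ## §1 The `3`-torsion of `y² = x³ + B` in characteristic `0` -/

section ThreeTorsion

variable {L : Type*} [Field L] [CharZero L] {B : L} (E : WeierstrassCurve L)
  (ha₁ : E.a₁ = 0) (ha₂ : E.a₂ = 0) (ha₃ : E.a₃ = 0) (ha₄ : E.a₄ = 0) (ha₆ : E.a₆ = B)

omit [CharZero L] in
include ha₁ ha₂ ha₃ ha₄ ha₆ in
/-- The affine equation reads `y² = x³ + B`. [folklore] -/
private theorem eq_of_nonsingular_aux {x y : L} (hP : E.toAffine.Nonsingular x y) : y ^ 2 = x ^ 3 + B := by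
  have := (Affine.equation_iff x y).mp hP.left
  rw [ha₁, ha₂, ha₃, ha₄, ha₆] at this
  linear_combination this

include ha₁ ha₂ ha₃ ha₄ in
/-- Duplication of `P = (x, y)`, `y ≠ 0`: `2P = (x₂, y₂)` with `ℓ·2y = 3x²`, `x₂ = ℓ² − 2x`, `y₂ = −(ℓ(x₂ − x) + y)`.
[cite: Knapp1993, Ch. V §6, proof of Thm. 5.3 ((5.33))] -/
private theorem two_nsmul_some_aux {x y : L} (hP : E.toAffine.Nonsingular x y) (hy0 : y ≠ 0) :
    ∃ (ℓ x₂ y₂ : L) (h : E.toAffine.Nonsingular x₂ y₂),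
      (2 : ℕ) • (Affine.Point.some x y hP) = Affine.Point.some x₂ y₂ h ∧
      ℓ * (2 * y) = 3 * x ^ 2 ∧ x₂ = ℓ ^ 2 - 2 * x ∧ y₂ = -(ℓ * (x₂ - x) + y) := by
  have hnegY : ∀ u v : L, E.toAffine.negY u v = -v := by
    intro u v; rw [Affine.negY, ha₁, ha₃]; ring
  have hy : y ≠ E.toAffine.negY x y := by
    intro hy; apply hy0; rw [hnegY] at hy; linear_combination hy / 2
  have hℓval : E.toAffine.slope x x y y * (2 * y) = 3 * x ^ 2 := by
    rw [E.toAffine.slope_of_Y_ne rfl hy, hnegY, ha₁, ha₂, ha₄]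
    field_simp
    ring
  have hx₂val : E.toAffine.addX x x (E.toAffine.slope x x y y) = E.toAffine.slope x x y y ^ 2 - 2 * x := by
    rw [Affine.addX, ha₁, ha₂]; ring
  have hy₂val : E.toAffine.addY x x y (E.toAffine.slope x x y y) =
      -(E.toAffine.slope x x y y * (E.toAffine.addX x x (E.toAffine.slope x x y y) - x) + y) := by
    rw [Affine.addY, Affine.negAddY, hnegY]
  have hQns : E.toAffine.Nonsingular (E.toAffine.addX x x (E.toAffine.slope x x y y))
      (E.toAffine.addY x x y (E.toAffine.slope x x y y)) :=
    Affine.nonsingular_add hP hP fun hxy => hy hxy.right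
  have hsum : (2 : ℕ) • (Affine.Point.some x y hP) = Affine.Point.some _ _ hQns := by
    rw [two_nsmul]; exact Affine.Point.add_self_of_Y_ne hy
  generalize E.toAffine.slope x x y y = ℓ at hℓval hx₂val hy₂val hQns hsum
  generalize E.toAffine.addX x x ℓ = x₂ at hx₂val hy₂val hQns hsum
  generalize E.toAffine.addY x x y ℓ = y₂ at hy₂val hQns hsum
  exact ⟨ℓ, x₂, y₂, hQns, hsum, hℓval, hx₂val, hy₂val⟩

include ha₁ ha₂ ha₃ ha₄ ha₆ in
/-- **A point `(x, y)` of `y² = x³ + B` killed by `3` has `y ≠ 0` and `x(x³ + 4B) = 0`** («`2P = −P` … `x⁴ = −4Bx`», any field of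
characteristic `0`). [cite: Knapp1993, Ch. V §6, proof of Thm. 5.3] -/
theorem three_nsmul_some_eq_zero {x y : L} (hP : E.toAffine.Nonsingular x y) (h3 : (3 : ℕ) • Affine.Point.some x y hP = 0) :
    y ≠ 0 ∧ x * (x ^ 3 + 4 * B) = 0 := by
  have hPeq := eq_of_nonsingular_aux E ha₁ ha₂ ha₃ ha₄ ha₆ hP
  have h2P : (2 : ℕ) • Affine.Point.some x y hP ≠ 0 := by
    intro h2
    have : Affine.Point.some x y hP = 0 := by
      have e : (3 : ℕ) • Affine.Point.some x y hP = (2 : ℕ) • Affine.Point.some x y hP + Affine.Point.some x y hP :=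
        succ_nsmul _ 2
      rw [h2, zero_add] at e
      rw [← e, h3]
    exact Affine.Point.some_ne_zero hP this
  have hy0 : y ≠ 0 := by
    intro hy0
    apply h2P
    rw [two_nsmul]
    exact Affine.Point.add_self_of_Y_eq (by rw [Affine.negY, ha₁, ha₃, hy0]; ring)
  obtain ⟨ℓ, x₂, y₂, hQns, hsum, hℓ, hx₂, hy₂⟩ := two_nsmul_some_aux E ha₁ ha₂ ha₃ ha₄ hP hy0
  refine ⟨hy0, ?_⟩
  have h2eq : (2 : ℕ) • Affine.Point.some x y hP = -Affine.Point.some x y hP := by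
    rw [eq_neg_iff_add_eq_zero, ← succ_nsmul]; exact h3
  rw [hsum, Affine.Point.neg_some, Affine.Point.some.injEq] at h2eq
  have hx₂x : x₂ = x := h2eq.1
  have hℓ2 : ℓ ^ 2 = 3 * x := by linear_combination hx₂.symm.trans hx₂x
  linear_combination ((2 * y * ℓ + 3 * x ^ 2) / 3) * hℓ - (4 * y ^ 2 / 3) * hℓ2 - 4 * x * hPeq

end ThreeTorsion

/-! ## §2 The sharp halves in kernel form -/

section Sharp

/-- ★ **`Ш(E/ℚ) ∩ ker f_* = 0` for `E = mordellCurve(−2p²)` under (h1), kernel form.** As P7b's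
`eq_zero_of_mem_sha_of_galH1Map_phi_eq_zero`, for ANY `Γ_ℚ`-equivariant surjection `f : E(ℚ̄) → W''(ℚ̄)` killing the points with `x = 0`
and whose kernel lies in `{O} ∪ {x = 0}` (e.g. the Vélu `3`-isogeny `φ`). [cite: CohenPazuki2009, Proposition 2.2 and §4]
[cite: SilvermanAEC2009, Thm. X.4.2 (a)] -/
theorem eq_zero_of_mem_sha_of_galH1Map_eq_zero_of_ker_x_zero_phi {F : Type} [Field F] [NumberField F]
    (hF2 : Module.finrank ℚ F = 2) {ω : F} (hω : ω ^ 2 = 6) (c : F ≃ₐ[ℚ] F) (hc : c ≠ 1) {p : ℕ} (hp : p.Prime) (hp9 : p % 9 = 8)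
    {a b : ℤ} (hab : a ^ 2 + 2 * b ^ 2 = p) (h1 : ∃ u₀ : (𝓞 F)ˣ, ∀ x : 𝓞 F, (u₀ : 𝓞 F) - x ^ 3 ∉ Ideal.span {(p : 𝓞 F)})
    {W'' : WeierstrassCurve ℚ} (f : geomPoints (mordellCurve (-2 * (p : ℚ) ^ 2)) →+ geomPoints W'')
    (hf : ∀ (σ : Field.absoluteGaloisGroup ℚ) (P : geomPoints (mordellCurve (-2 * (p : ℚ) ^ 2))), f (σ • P) = σ • f P)
    (hsurj : Function.Surjective f)
    (hf0 : ∀ (y : AlgebraicClosure ℚ) (h : ((mordellCurve (-2 * (p : ℚ) ^ 2)).baseChange (AlgebraicClosure ℚ)).toAffine.Nonsingular 0 y),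
      f (Affine.Point.some 0 y h) = 0)
    (hker : ∀ P, f P = 0 → P = 0 ∨ ∃ (y : AlgebraicClosure ℚ)
      (h : ((mordellCurve (-2 * (p : ℚ) ^ 2)).baseChange (AlgebraicClosure ℚ)).toAffine.Nonsingular 0 y), P = Affine.Point.some 0 y h)
    {c₀ : (mordellCurve (-2 * (p : ℚ) ^ 2)).galH1} (hc₀ : c₀ ∈ (mordellCurve (-2 * (p : ℚ) ^ 2)).sha) (h0 : galH1Map f hf c₀ = 0) :
    c₀ = 0 := by
  have hcω : c ω = -ω := algEquiv_omega hF2 hω hc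
  haveI : Algebra.IsQuadraticExtension ℚ F := { finrank_eq_two' := hF2 }
  haveI : IsGalois ℚ F := inferInstance
  have hp0 : (p : ℚ) ≠ 0 := Nat.cast_ne_zero.mpr hp.ne_zero
  have hk0 : (-2 * (p : ℚ) ^ 2) ≠ 0 := mul_ne_zero (by norm_num) (pow_ne_zero 2 hp0)
  have hd24 := discr_eq_twentyFour hF2 hω
  have hL : ∀ q : F, q ^ 2 ≠ -3 := sq_ne_neg_three_of_discr_pos hF2 (by rw [hd24]; norm_num)
  have hc2 : ∀ x : F, (c : F ≃+* F) ((c : F ≃+* F) x) = x := fun x => algEquiv_apply_apply_of_finrank_eq_two hF2 c x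
  obtain ⟨cbar, hcbar, hcbθ⟩ := exists_lift_neg_theta' hL (c : F ≃+* F)
  have hdeg : Nat.Coprime 3 (Module.finrank ℚ F) := by rw [hF2]; decide
  have hω0 : ω ≠ 0 := fun h => by rw [h] at hω; norm_num at hω
  have hc' : (p * ω / 3 : F) ≠ 0 := div_ne_zero (mul_ne_zero (Nat.cast_ne_zero.mpr hp.ne_zero) hω0) three_ne_zero
  have hD : algebraMap ℚ F (-2 * (p : ℚ) ^ 2) = -3 * (p * ω / 3) ^ 2 := by
    rw [map_mul, map_pow, map_natCast, map_neg, map_ofNat]; linear_combination ((p : F) ^ 2 / 3) * hω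
  obtain ⟨𝒯, h₀, hT𝒯, hbox𝒯⟩ := exists_muThreeKernel_of_eq hc' hD (mordellCurve_baseChange (-2 * (p : ℚ) ^ 2) F)
  have hy : cbar (sCoord (p * ω / 3 : F)) = sCoord (p * ω / 3 : F) := by
    have hcc : (c : F ≃+* F) (p * ω / 3) = -(p * ω / 3) := by
      change c (p * ω / 3) = -(p * ω / 3)
      rw [map_div₀, map_mul, map_natCast, map_ofNat, hcω]; ring
    rw [sCoord, map_mul, hcbar, hcbθ, hcc, map_neg]; ring
  obtain ⟨T, hT⟩ := exists_geomPoint_transport 𝒯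
  obtain ⟨s₁, hs₁0, hTs₁, -⟩ := exists_transport_eq_some_zero hT hT𝒯
  have hs₁ : s₁ ^ 2 = algebraMap ℚ (AlgebraicClosure ℚ) (-2 * (p : ℚ) ^ 2) := sq_eq_of_nonsingular_zero hs₁0
  have hV₁ := isVeluThreePair_of_sq_eq hk0 hs₁
  have hTV : hV₁.T = T := by rw [hTs₁]; exact point_some_ext rfl rfl
  have hfT : f T = 0 := by rw [hTs₁]; exact hf0 s₁ hs₁0
  have hker' : ∀ P, f P = 0 → P = 0 ∨ P = T ∨ P = -T := by
    intro P hP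
    rcases hker P hP with h | ⟨y, hy', rfl⟩
    · exact Or.inl h
    · right; rw [← hTV]; exact hV₁.some_eq_T_or hy' rfl
  have hbox : ∀ {u : F} (hu : u ≠ 0), (∃ r : F, (c : F ≃+* F) r = r ∧ r ≠ 0 ∧ u * (c : F ≃+* F) u = r ^ 3) →
      𝒯.torsorClass hu ∈ ((mordellCurve (-2 * (p : ℚ) ^ 2)).baseChange F).sha → 𝒯.torsorClass hu = 0 := by
    intro u hu hn
    have hn' : ∃ r : F, c r = r ∧ r ≠ 0 ∧ u * c u = r ^ 3 := hn
    exact hbox𝒯 hu (fun hs' => torsorClass_eq_zero_of_mem_sha_of_norm_cube_phi hF2 hω c hp hp9 hab h1 hc' hD hu hn' hs')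
  exact eq_zero_of_mem_sha_of_galH1Map_eq_zero_of_box_transport (c : F ≃+* F) hc2 cbar hcbar hcbθ hL hdeg 𝒯 hT hT𝒯
    (map_zero cbar) hy f hf hsurj hfT hker' hbox hc₀ h0

/-- ★ **`Ш(E'/ℚ) ∩ ker f_* = 0` for `E' = mordellCurve(54p²)` under (h2) `9 ∤ a`, kernel form.** As P7a's
`eq_zero_of_mem_sha_of_galH1Map_phiHat_eq_zero`, for ANY `Γ_ℚ`-equivariant surjection `f : E'(ℚ̄) → W''(ℚ̄)` killing the points with
`x = 0` and whose kernel lies in `{O} ∪ {x = 0}` (e.g. the dual isogeny `ψ = φ̂`). [cite: CohenPazuki2009, Proposition 2.2 and §4]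
[cite: SilvermanAEC2009, Thm. X.4.2 (a)] -/
theorem eq_zero_of_mem_sha_of_galH1Map_eq_zero_of_ker_x_zero_phiHat {K : Type} [Field K] [NumberField K] {θ : K}
    (hK : SqrtNegTwo.FieldData θ) (c : K ≃ₐ[ℚ] K) (hc : c ≠ 1) {p : ℕ} (hp : p.Prime) (hp9 : p % 9 = 8) {a b : ℤ}
    (hab : a ^ 2 + 2 * b ^ 2 = p) (h9 : ¬ (9 : ℤ) ∣ a)
    {W'' : WeierstrassCurve ℚ} (f : geomPoints (mordellCurve (54 * (p : ℚ) ^ 2)) →+ geomPoints W'')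
    (hf : ∀ (σ : Field.absoluteGaloisGroup ℚ) (P : geomPoints (mordellCurve (54 * (p : ℚ) ^ 2))), f (σ • P) = σ • f P)
    (hsurj : Function.Surjective f)
    (hf0 : ∀ (y : AlgebraicClosure ℚ) (h : ((mordellCurve (54 * (p : ℚ) ^ 2)).baseChange (AlgebraicClosure ℚ)).toAffine.Nonsingular 0 y),
      f (Affine.Point.some 0 y h) = 0)
    (hker : ∀ P, f P = 0 → P = 0 ∨ ∃ (y : AlgebraicClosure ℚ)
      (h : ((mordellCurve (54 * (p : ℚ) ^ 2)).baseChange (AlgebraicClosure ℚ)).toAffine.Nonsingular 0 y), P = Affine.Point.some 0 y h)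
    {c₀ : (mordellCurve (54 * (p : ℚ) ^ 2)).galH1} (hc₀ : c₀ ∈ (mordellCurve (54 * (p : ℚ) ^ 2)).sha) (h0 : galH1Map f hf c₀ = 0) :
    c₀ = 0 := by
  have hK2 := hK.finrank_eq
  have hθ := hK.sq_eq
  have hcθ : c θ = -θ := hK.algEquiv_theta hc
  haveI : Algebra.IsQuadraticExtension ℚ K := { finrank_eq_two' := hK2 }
  haveI : IsGalois ℚ K := inferInstance
  have hp0 : (p : ℚ) ≠ 0 := Nat.cast_ne_zero.mpr hp.ne_zero
  have hk0 : (54 * (p : ℚ) ^ 2) ≠ 0 := mul_ne_zero (by norm_num) (pow_ne_zero 2 hp0)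
  have hL : ∀ q : K, q ^ 2 ≠ -3 := sq_ne_neg_three hK
  have hc2 : ∀ x : K, (c : K ≃+* K) ((c : K ≃+* K) x) = x := fun x => algEquiv_apply_apply hK c x
  obtain ⟨cbar, hcbar, hcbθ⟩ := exists_lift_neg_theta' hL (c : K ≃+* K)
  have hdeg : Nat.Coprime 3 (Module.finrank ℚ K) := by rw [hK2]; decide
  have hθ0 : θ ≠ 0 := fun h => by rw [h] at hθ; norm_num at hθ
  have hc' : (3 * p * θ : K) ≠ 0 := mul_ne_zero (mul_ne_zero three_ne_zero (Nat.cast_ne_zero.mpr hp.ne_zero)) hθ0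
  have hD : algebraMap ℚ K (54 * (p : ℚ) ^ 2) = -3 * (3 * p * θ) ^ 2 := by
    rw [map_mul, map_pow, map_natCast, map_ofNat]; linear_combination (27 * (p : K) ^ 2) * hθ
  obtain ⟨𝒯, h₀, hT𝒯, hbox𝒯⟩ := exists_muThreeKernel_of_eq hc' hD (mordellCurve_baseChange (54 * (p : ℚ) ^ 2) K)
  have hy : cbar (sCoord (3 * p * θ : K)) = sCoord (3 * p * θ : K) := by
    have hcc : (c : K ≃+* K) (3 * p * θ) = -(3 * p * θ) := by
      change c (3 * p * θ) = -(3 * p * θ)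
      rw [map_mul, map_mul, map_natCast, map_ofNat, hcθ]; ring
    rw [sCoord, map_mul, hcbar, hcbθ, hcc, map_neg]; ring
  obtain ⟨T, hT⟩ := exists_geomPoint_transport 𝒯
  obtain ⟨s₁, hs₁0, hTs₁, -⟩ := exists_transport_eq_some_zero hT hT𝒯
  have hs₁ : s₁ ^ 2 = algebraMap ℚ (AlgebraicClosure ℚ) (54 * (p : ℚ) ^ 2) := sq_eq_of_nonsingular_zero hs₁0
  have hV₁ := isVeluThreePair_of_sq_eq hk0 hs₁
  have hTV : hV₁.T = T := by rw [hTs₁]; exact point_some_ext rfl rfl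
  have hfT : f T = 0 := by rw [hTs₁]; exact hf0 s₁ hs₁0
  have hker' : ∀ P, f P = 0 → P = 0 ∨ P = T ∨ P = -T := by
    intro P hP
    rcases hker P hP with h | ⟨y, hy', rfl⟩
    · exact Or.inl h
    · right; rw [← hTV]; exact hV₁.some_eq_T_or hy' rfl
  have hbox : ∀ {u : K} (hu : u ≠ 0), (∃ r : K, (c : K ≃+* K) r = r ∧ r ≠ 0 ∧ u * (c : K ≃+* K) u = r ^ 3) →
      𝒯.torsorClass hu ∈ ((mordellCurve (54 * (p : ℚ) ^ 2)).baseChange K).sha → 𝒯.torsorClass hu = 0 := by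
    intro u hu hn
    have hn' : ∃ r : K, c r = r ∧ r ≠ 0 ∧ u * c u = r ^ 3 := hn
    exact hbox𝒯 hu (fun hs' => torsorClass_eq_zero_of_mem_sha_of_norm_cube hK c hc hp hp9 hab h9 hc' hD hu hn' hs')
  exact eq_zero_of_mem_sha_of_galH1Map_eq_zero_of_box_transport (c : K ≃+* K) hc2 cbar hcbar hcbθ hL hdeg 𝒯 hT hT𝒯
    (map_zero cbar) hy f hf hsurj hfT hker' hbox hc₀ h0

end Sharp

end Summit.BirchSwinnertonDyer.BirchSwinnertonDyer.Theorems.SylvesterTwistDescent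

end
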